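import Summits.MatrixMultiplication.MatrixMultiplication.Theses.LevelGradedCohnUmans

/-!
# Crux GradedDesignFamily (stmt-MatrixMultiplication-7610) — ideator 3, round 1: first lemmas of three levers

All statements are over existing declarations; `sorry` is allowed at this stage (crux-ideate: "it need
not be proved, it must elaborate").  Namespace is private to this seat.

* Card `schur-weyl-row-cell`      — row grading of `S_n` (tests on `r`-ary words), `rowEngineLink`,
                                     `powerSet_universality`.
* Card `abelian-label-amplification` — host `H × Multiplicative (ZMod N)`, tests `J_H ⊗ ℂ[A]`,
                                     fibre criterion `labelSep_iff`, `labelLink`.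
* Card `graded-stpp-wreath`        — simultaneously `J`-separated families, graded CKSU inequality,
                                     `gradedCKSU_transfer`.
-/

noncomputable section

open scoped BigOperators Matrix

namespace Summit.MatrixMultiplication.MatrixMultiplication.Cruxes.GradedDesignFamily.Ideator3

open Literature.RepresentationTheory.FiniteGroups (irrChars)
open Literature.NumberTheory.DiophantineGeometry (numStandardTableaux)
open Literature.Combinatorics.Additive (SimultaneousTPP TripleProductProperty)
open Summit.MatrixMultiplication.MatrixMultiplication.Theses.LevelGradedCohnUmans
  (GradedDesignFamily GradedPricing)

/-! ## Common vocabulary (verbatim from the crux) -/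

/-- The separation clause of `GradedDesignFamily`, for an arbitrary test set `J ⊆ ℂ^G`. -/
def JSep {G : Type} [Group G] (J : Set (G → ℂ)) (X Y Z : Finset G) : Prop :=
  ∀ x₀ ∈ X, ∀ z₀ ∈ Z, ∃ f ∈ J, ∀ x ∈ X, ∀ y ∈ Y, ∀ y' ∈ Y, ∀ z ∈ Z,
    (x = x₀ ∧ y = y' ∧ z = z₀ → f (x⁻¹ * y * y'⁻¹ * z) = 1) ∧
    (¬ (x = x₀ ∧ y = y' ∧ z = z₀) → f (x⁻¹ * y * y'⁻¹ * z) = 0)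

/-- Bi-invariance clause of the crux. -/
def BiInvariant {G : Type} [Group G] (J : Set (G → ℂ)) : Prop :=
  ∀ f ∈ J, ∀ a b : G, (fun g : G => f (a * g * b)) ∈ J

/-- The graded budget `Σ_{χ ∈ Irr G ∩ J} χ(1)^s` of the crux. -/
def gradedBudget (G : Type) [Group G] (J : Set (G → ℂ)) (s : ℝ) : ℝ :=
  ∑ᶠ χ ∈ irrChars G ∩ J, (χ 1).re ^ s

/-- Sanity: the crux is literally `∀ ε > 0, ∃ G J X Y Z, BiInvariant J ∧ JSep J X Y Z ∧ budget < V^…`. -/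
theorem gradedDesignFamily_iff :
    GradedDesignFamily ↔ ∀ ε : ℝ, 0 < ε → ∃ (G : Type) (_ : Group G) (_ : Fintype G)
      (J : Submodule ℂ (G → ℂ)) (X Y Z : Finset G), BiInvariant (J : Set (G → ℂ)) ∧
      JSep (J : Set (G → ℂ)) X Y Z ∧
      gradedBudget G (J : Set (G → ℂ)) (2 + ε) < ((X.card * Y.card * Z.card : ℕ) : ℝ) ^ ((2 + ε) / 3) :=
  Iff.rfl

/-! ## Card A — `schur-weyl-row-cell`: grading `S_n` by the number of rows -/

/-- Row-`r` (Schur–Weyl) tests on `S_n`: matrix coefficients of the permutation action on `r`-ary words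
`w : Fin n → Fin r`, `f(g) = Σ_w c_w (w ∘ g)`.  For `r = 2` these are the linear combinations of the
set-transport indicators `[g(A) = A']`.  `Irr ∩ rowTests n r = {χ_λ : ℓ(λ) ≤ r}` (Schur–Weyl / Young's
rule for `M^{β_r}`), kernel of `ℂS_n → End((ℂ^r)^{⊗ n})` = de Concini–Procesi ideal `J(n,r)`. -/
def rowTests (n r : ℕ) : Set (Equiv.Perm (Fin n) → ℂ) :=
  {f | ∃ c : (Fin n → Fin r) → (Fin n → Fin r) → ℂ, ∀ g, f g = ∑ w : Fin n → Fin r, c w (w ∘ ⇑g)}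

/-- Row-`r` separation of a triple in `S_n` (the crux's clause with `J = rowTests n r`, coefficients
inlined exactly as in the route's `SnLevelDesigns`). -/
def RowSep (n r : ℕ) (X Y Z : Finset (Equiv.Perm (Fin n))) : Prop :=
  ∀ x₀ ∈ X, ∀ z₀ ∈ Z, ∃ c : (Fin n → Fin r) → (Fin n → Fin r) → ℂ,
    ∀ x ∈ X, ∀ y ∈ Y, ∀ y' ∈ Y, ∀ z ∈ Z,
      (∑ w : Fin n → Fin r, c w (w ∘ ⇑(x⁻¹ * y * y'⁻¹ * z))) =
        if x = x₀ ∧ y = y' ∧ z = z₀ then 1 else 0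

/-- The row budget `Σ_{μ ⊢ n, ℓ(μ) ≤ r} f_μ^s`. -/
def rowBudget (n r : ℕ) (s : ℝ) : ℝ :=
  ∑ μ : Nat.Partition n, if Multiset.card μ.parts ≤ r then (numStandardTableaux μ : ℝ) ^ s else 0

/-- ROW BUDGET (the analogue of the route's `TokenBudget`): every irreducible character of `S_n` inside
the row-`r` test space is `χ_μ` with `ℓ(μ) ≤ r`. [Schur–Weyl duality; Young's rule for `M^{β_r}`] -/
def RowBudget : Prop :=
  ∀ (n r : ℕ) (s : ℝ), gradedBudget (Equiv.Perm (Fin n)) (rowTests n r) s ≤ rowBudget n r s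

/-- The ROW ENGINE: `∀ ε ∃ n r` and a row-`r`-separated triple beating the row budget. -/
def SnRowDesigns : Prop :=
  ∀ ε : ℝ, 0 < ε → ∃ (n r : ℕ) (X Y Z : Finset (Equiv.Perm (Fin n))),
    RowSep n r X Y Z ∧ rowBudget n r (2 + ε) < ((X.card * Y.card * Z.card : ℕ) : ℝ) ^ ((2 + ε) / 3)

-- FIRST LEMMA of card A (PROVED below as `rowEngineLink`, same packaging as the route's
-- `SnEngineLink`): the row test space is a bi-invariant submodule (`f(agb) = Σ_w c_w (w∘a∘g∘b)`:
-- reindex `w ↦ w ∘ a`, absorb `b`), row separators are `J`-separators verbatim, and the budget is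
-- bounded by `RowBudget`.  Plumbing first.
/-- `c ↦ (g ↦ Σ_w c w (w ∘ g))`. -/
def wordFn {n r : ℕ} (c : (Fin n → Fin r) → (Fin n → Fin r) → ℂ) (g : Equiv.Perm (Fin n)) : ℂ :=
  ∑ w : Fin n → Fin r, c w (w ∘ ⇑g)

/-- Two-sided translation invariance of the row test space, with the explicit re-indexed table:
`wordFn c (a g b) = wordFn c' g`, `c' w u = c (w ∘ a⁻¹) (u ∘ b)` (reindex `w ↦ w ∘ a`). -/
theorem wordFn_translate {n r : ℕ} (c : (Fin n → Fin r) → (Fin n → Fin r) → ℂ)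
    (a b g : Equiv.Perm (Fin n)) :
    wordFn c (a * g * b) = wordFn (fun w u => c (w ∘ ⇑a⁻¹) (u ∘ ⇑b)) g := by
  unfold wordFn
  let e : (Fin n → Fin r) ≃ (Fin n → Fin r) := Equiv.arrowCongr a.symm (Equiv.refl (Fin r))
  symm
  rw [← e.sum_comp]
  refine Finset.sum_congr rfl fun w _ => ?_
  have h1 : (e w ∘ ⇑a⁻¹ : Fin n → Fin r) = w := by
    funext i; simp [e, Equiv.arrowCongr_apply, Equiv.Perm.inv_def]
  have h2 : ((e w ∘ ⇑g) ∘ ⇑b : Fin n → Fin r) = w ∘ ⇑(a * g * b) := by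
    funext i; simp [e, Equiv.arrowCongr_apply]
  simp only [h1, h2]

/-- The word map as a linear map and the row test space as a submodule (`= rowTests n r`). -/
def wordMap (n r : ℕ) : ((Fin n → Fin r) → (Fin n → Fin r) → ℂ) →ₗ[ℂ] (Equiv.Perm (Fin n) → ℂ) where
  toFun c := wordFn c
  map_add' c c' := by
    funext g; simp [wordFn, Finset.sum_add_distrib]
  map_smul' s c := by
    funext g; simp [wordFn, Finset.mul_sum]

/-- The row-`r` test space `J_(r) ≤ ℂ^{S_n}` as a submodule. -/
def rowSpace (n r : ℕ) : Submodule ℂ (Equiv.Perm (Fin n) → ℂ) :=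
  LinearMap.range (wordMap n r)

theorem mem_rowSpace_iff {n r : ℕ} (f : Equiv.Perm (Fin n) → ℂ) :
    f ∈ rowSpace n r ↔ f ∈ rowTests n r := by
  constructor
  · rintro ⟨c, rfl⟩
    exact ⟨c, fun g => rfl⟩
  · rintro ⟨c, hc⟩
    exact ⟨c, (funext hc).symm⟩

theorem coe_rowSpace (n r : ℕ) :
    ((rowSpace n r : Submodule ℂ (Equiv.Perm (Fin n) → ℂ)) : Set (Equiv.Perm (Fin n) → ℂ)) =
      rowTests n r := by
  ext f
  exact mem_rowSpace_iff f

/-- FIRST LEMMA of card A, PROVED: the row engine feeds the crux by name (bi-invariance by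
`wordFn_translate`, separators verbatim, budget by `RowBudget`). -/
theorem rowEngineLink : RowBudget → SnRowDesigns → GradedDesignFamily := by
  intro hB hD ε hε
  obtain ⟨n, r, X, Y, Z, hsep, hlt⟩ := hD ε hε
  refine ⟨Equiv.Perm (Fin n), inferInstance, inferInstance, rowSpace n r, X, Y, Z, ?_, ?_, ?_⟩
  · intro f hf a b
    obtain ⟨c, rfl⟩ := hf
    exact ⟨fun w u => c (w ∘ ⇑a⁻¹) (u ∘ ⇑b), funext fun g => (wordFn_translate c a b g).symm⟩
  · intro x₀ hx₀ z₀ hz₀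
    obtain ⟨c, hc⟩ := hsep x₀ hx₀ z₀ hz₀
    refine ⟨wordFn c, ⟨c, rfl⟩, fun x hx y hy y' hy' z hz => ?_⟩
    have key := hc x hx y hy y' hy' z hz
    refine ⟨fun h => ?_, fun h => ?_⟩
    · unfold wordFn; rw [key, if_pos h]
    · unfold wordFn; rw [key, if_neg h]
  · rw [coe_rowSpace]
    exact lt_of_le_of_lt (hB n r (2 + ε)) hlt

/-- The smallest row cell `r = 2` (POWER-SET DESIGNS): a wall-saturating family up to a constant.
`D_2(n) = Σ_{2 rows} f_λ² = #{lds ≤ 2} = catalan n`. -/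
def PowerSetWallFamily : Prop :=
  ∃ c : ℝ, 0 < c ∧ ∀ n₀ : ℕ, ∃ n : ℕ, n₀ ≤ n ∧ ∃ X Y Z : Finset (Equiv.Perm (Fin n)),
    RowSep n 2 X Y Z ∧ c * (catalan n : ℝ) ^ (3 / 2 : ℝ) ≤ ((X.card * Y.card * Z.card : ℕ) : ℝ)

/-- Regev-type two-row asymptotics in the (little-o) form the transfer needs (named-fact shape; Regev 1981:
`Σ_{ℓ(λ)≤2} f_λ^s ≍ 2^{sn} n^{-s+1/2}` while `catalan n ≍ 4^n n^{-3/2}`, so `rowBudget n 2 s / (catalan n)^{s/2} ≍ n^{-(s-2)/4} → 0`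
for every `s > 2`; numerically `N_eff(2,n) = 0.883 √n`). Only the two-row hook-length formula
`f_{(n-j,j)} = C(n,j) - C(n,j-1)` and Stirling are needed to prove it. -/
def RegevTwoRows : Prop :=
  ∀ s : ℝ, 2 < s → ∀ c : ℝ, 0 < c → ∃ n₁ : ℕ, ∀ n : ℕ, n₁ ≤ n →
    rowBudget n 2 s < c * (catalan n : ℝ) ^ (s / 2)

/-- UNIVERSALITY OF THE SMALLEST ROW CELL, PROVED modulo the two named facts `RegevTwoRows` (asymptotics)
and `RowBudget` (Schur–Weyl): constant-factor wall saturation at `r = 2` along `n → ∞` gives the crux for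
EVERY `ε` (budget `< c^{s/3}·Cat^{s/2} = (c·Cat^{3/2})^{s/3} ≤ V^{s/3}`, `s = 2 + ε`). -/
theorem powerSet_universality :
    RegevTwoRows → RowBudget → PowerSetWallFamily → GradedDesignFamily := by
  intro hR hB hF ε hε
  obtain ⟨c, hc, hfam⟩ := hF
  set s : ℝ := 2 + ε with hs
  have hs2 : 2 < s := by rw [hs]; linarith
  have hs3 : 0 ≤ s / 3 := by rw [hs]; positivity
  -- the constant the budget must undercut
  have hc' : 0 < c ^ (s / 3) := Real.rpow_pos_of_pos hc _
  obtain ⟨n₁, hn₁⟩ := hR s hs2 (c ^ (s / 3)) hc'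
  obtain ⟨n, hn, X, Y, Z, hsep, hvol⟩ := hfam n₁
  refine ⟨Equiv.Perm (Fin n), inferInstance, inferInstance, rowSpace n 2, X, Y, Z, ?_, ?_, ?_⟩
  · intro f hf a b
    obtain ⟨d, rfl⟩ := hf
    exact ⟨fun w u => d (w ∘ ⇑a⁻¹) (u ∘ ⇑b), funext fun g => (wordFn_translate d a b g).symm⟩
  · intro x₀ hx₀ z₀ hz₀
    obtain ⟨d, hd⟩ := hsep x₀ hx₀ z₀ hz₀
    refine ⟨wordFn d, ⟨d, rfl⟩, fun x hx y hy y' hy' z hz => ?_⟩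
    have key := hd x hx y hy y' hy' z hz
    refine ⟨fun h => ?_, fun h => ?_⟩
    · unfold wordFn; rw [key, if_pos h]
    · unfold wordFn; rw [key, if_neg h]
  · rw [coe_rowSpace]
    have hcat : 0 ≤ (catalan n : ℝ) := Nat.cast_nonneg _
    have h1 : gradedBudget (Equiv.Perm (Fin n)) (rowTests n 2) (2 + ε) < c ^ (s / 3) * (catalan n : ℝ) ^ (s / 2) := by
      rw [← hs]; exact lt_of_le_of_lt (hB n 2 s) (hn₁ n hn)
    have h2 : c ^ (s / 3) * (catalan n : ℝ) ^ (s / 2) = (c * (catalan n : ℝ) ^ (3 / 2 : ℝ)) ^ (s / 3) := by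
      rw [Real.mul_rpow hc.le (Real.rpow_nonneg hcat _), ← Real.rpow_mul hcat]
      congr 2
      ring
    have h3 : (c * (catalan n : ℝ) ^ (3 / 2 : ℝ)) ^ (s / 3) ≤
        ((X.card * Y.card * Z.card : ℕ) : ℝ) ^ ((2 + ε) / 3) := by
      rw [← hs]
      exact Real.rpow_le_rpow (by positivity) hvol hs3
    calc gradedBudget (Equiv.Perm (Fin n)) (rowTests n 2) (2 + ε)
        < c ^ (s / 3) * (catalan n : ℝ) ^ (s / 2) := h1
      _ = (c * (catalan n : ℝ) ^ (3 / 2 : ℝ)) ^ (s / 3) := h2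
      _ ≤ ((X.card * Y.card * Z.card : ℕ) : ℝ) ^ ((2 + ε) / 3) := h3

/-! ## Card B′ — `abelian-label-amplification`: host `H × A`, tests `J_H ⊗ ℂ[A]` -/

/-- Label tests on `H × A`: functions all of whose `A`-slices lie in `J_H` (`= J_H ⊗ ℂ^A`). For
bi-invariant `J_H` this is bi-invariant, `Irr(H × A) ∩ labelTests = {χ ⊗ λ : χ ∈ Irr H ∩ J_H, λ ∈ Â}`,
so `N_eff` is multiplied by `|A|` and the budget by `|A|`. -/
def labelTests (H A : Type) (J : Set (H → ℂ)) : Set (H × A → ℂ) :=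
  {F | ∀ a : A, (fun h : H => F (h, a)) ∈ J}

/-- FIRST LEMMA of card B′ (FIBRE CRITERION, elementary): a triple in `H × A` is separated by label
tests iff every target is `J_H`-separated from the `H`-parts of the quadruples IN ITS OWN LABEL CLASS
(other classes are killed by the zero slice). -/
theorem labelSep_iff {H A : Type} [Group H] [Group A] [DecidableEq A]
    (J : Submodule ℂ (H → ℂ)) (X Y Z : Finset (H × A)) :
    JSep (labelTests H A (J : Set (H → ℂ))) X Y Z ↔
      ∀ x₀ ∈ X, ∀ z₀ ∈ Z, ∃ f ∈ J, ∀ x ∈ X, ∀ y ∈ Y, ∀ y' ∈ Y, ∀ z ∈ Z,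
        x.2⁻¹ * y.2 * y'.2⁻¹ * z.2 = x₀.2⁻¹ * z₀.2 →
          ((x = x₀ ∧ y = y' ∧ z = z₀ → f (x.1⁻¹ * y.1 * y'.1⁻¹ * z.1) = 1) ∧
           (¬ (x = x₀ ∧ y = y' ∧ z = z₀) → f (x.1⁻¹ * y.1 * y'.1⁻¹ * z.1) = 0)) := by
  classical
  have e1 : ∀ x y y' z : H × A, (x⁻¹ * y * y'⁻¹ * z).1 = x.1⁻¹ * y.1 * y'.1⁻¹ * z.1 := by
    intro x y y' z; simp only [Prod.fst_mul, Prod.fst_inv]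
  have e2 : ∀ x y y' z : H × A, (x⁻¹ * y * y'⁻¹ * z).2 = x.2⁻¹ * y.2 * y'.2⁻¹ * z.2 := by
    intro x y y' z; simp only [Prod.snd_mul, Prod.snd_inv]
  have key : ∀ x y y' z : H × A,
      x⁻¹ * y * y'⁻¹ * z = (x.1⁻¹ * y.1 * y'.1⁻¹ * z.1, x.2⁻¹ * y.2 * y'.2⁻¹ * z.2) := by
    intro x y y' z; exact Prod.ext (e1 x y y' z) (e2 x y y' z)
  constructor
  · intro h x₀ hx₀ z₀ hz₀
    obtain ⟨F, hF, hsep⟩ := h x₀ hx₀ z₀ hz₀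
    refine ⟨fun hh => F (hh, x₀.2⁻¹ * z₀.2), hF _, fun x hx y hy y' hy' z hz hlab => ?_⟩
    dsimp only
    have := hsep x hx y hy y' hy' z hz
    rwa [key, hlab] at this
  · intro h x₀ hx₀ z₀ hz₀
    obtain ⟨f, hf, hsep⟩ := h x₀ hx₀ z₀ hz₀
    refine ⟨fun g => if g.2 = x₀.2⁻¹ * z₀.2 then f g.1 else 0, ?_, fun x hx y hy y' hy' z hz => ?_⟩
    · intro a
      by_cases ha : a = x₀.2⁻¹ * z₀.2
      · simp only [ha, if_true]; exact hf
      · simp only [ha, if_false]; exact (J : Submodule ℂ (H → ℂ)).zero_mem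
    · rw [key]
      dsimp only
      by_cases hlab : x.2⁻¹ * y.2 * y'.2⁻¹ * z.2 = x₀.2⁻¹ * z₀.2
      · rw [if_pos hlab]
        exact hsep x hx y hy y' hy' z hz hlab
      · rw [if_neg hlab]
        refine ⟨fun ht => absurd ?_ hlab, fun _ => rfl⟩
        obtain ⟨rfl, rfl, rfl⟩ := ht
        simp [mul_inv_cancel_right]

/-- LABEL BUDGET: the graded budget of `J_H ⊗ ℂ[ℤ/N]` is `N` times that of `J_H`. [Irr(H × A) = Irr H × Â] -/
def LabelBudget : Prop :=
  ∀ (H : Type) [Group H] [Fintype H] (N : ℕ) [NeZero N] (J : Submodule ℂ (H → ℂ)),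
    BiInvariant (J : Set (H → ℂ)) → ∀ s : ℝ,
      gradedBudget (H × Multiplicative (ZMod N))
          (labelTests H (Multiplicative (ZMod N)) (J : Set (H → ℂ))) s
        = N * gradedBudget H (J : Set (H → ℂ)) s

/-- LABELLED DESIGNS: for every `ε`, some host `H`, bi-invariant `J_H`, label group `ℤ/N` and a
label-separated triple in `H × ℤ/N` beating `N · Σ_{Irr H ∩ J_H} χ(1)^{2+ε}`. -/
def LabelledDesigns : Prop :=
  ∀ ε : ℝ, 0 < ε → ∃ (H : Type) (_ : Group H) (_ : Fintype H) (N : ℕ) (_ : NeZero N)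
    (J : Submodule ℂ (H → ℂ)) (X Y Z : Finset (H × Multiplicative (ZMod N))),
    BiInvariant (J : Set (H → ℂ)) ∧
    JSep (labelTests H (Multiplicative (ZMod N)) (J : Set (H → ℂ))) X Y Z ∧
    (N : ℝ) * gradedBudget H (J : Set (H → ℂ)) (2 + ε) <
      ((X.card * Y.card * Z.card : ℕ) : ℝ) ^ ((2 + ε) / 3)

/-- The label test space as a submodule (carrier `= labelTests`). -/
def labelSpace (H A : Type) (J : Submodule ℂ (H → ℂ)) : Submodule ℂ (H × A → ℂ) where
  carrier := labelTests H A (J : Set (H → ℂ))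
  add_mem' {F G} hF hG := fun a => J.add_mem (hF a) (hG a)
  zero_mem' := fun a => J.zero_mem
  smul_mem' s F hF := fun a => J.smul_mem s (hF a)

/-- The label link, PROVED modulo the character bookkeeping `LabelBudget`: labelled designs are
instances of the crux with `G = H × ℤ/N`, `J = J_H ⊗ ℂ[ℤ/N]`. -/
theorem labelLink : LabelBudget → LabelledDesigns → GradedDesignFamily := by
  intro hB hD ε hε
  obtain ⟨H, _, _, N, _, J, X, Y, Z, hJ, hsep, hlt⟩ := hD ε hε
  refine ⟨H × Multiplicative (ZMod N), inferInstance, inferInstance,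
    labelSpace H (Multiplicative (ZMod N)) J, X, Y, Z, ?_, ?_, ?_⟩
  · intro F hF a b t
    have hslice : (fun h : H => F (h, a.2 * t * b.2)) ∈ (J : Set (H → ℂ)) := hF (a.2 * t * b.2)
    have := hJ _ hslice a.1 b.1
    have key : (fun h : H => F (a * (h, t) * b)) = fun g : H => F (a.1 * g * b.1, a.2 * t * b.2) := by
      funext g; simp [Prod.mul_def]
    show (fun h : H => F (a * (h, t) * b)) ∈ (J : Set (H → ℂ))
    rw [key]; exact this
  · exact hsep
  · show (∑ᶠ χ ∈ irrChars (H × Multiplicative (ZMod N)) ∩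
        labelTests H (Multiplicative (ZMod N)) (J : Set (H → ℂ)), (χ 1).re ^ (2 + ε)) < _
    have := hB H N J hJ (2 + ε)
    unfold gradedBudget at this
    rw [this]
    exact hlt

/-- What the abelian factor can never do BY ITSELF (product designs lose exactly the abelian deficit):
for a triple of the product form `X = X_H ×ˢ S`, `Y = Y_H ×ˢ T`, `Z = Z_H ×ˢ U` separation forces the
TPP on `(S,T,U)` in the abelian group, hence `|S||T||U| ≤ N` (Cohn–Umans), so the label factor
contributes `≤ N` to `V` against `N` in the budget: super-additive ('helical') designs are required. -/
def ProductDesignLoss : Prop :=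
  ∀ (H : Type) [Group H] (N : ℕ) [NeZero N] (J : Set (H → ℂ)) (XH YH ZH : Finset H)
    (S T U : Finset (Multiplicative (ZMod N))),
    XH.Nonempty → YH.Nonempty → ZH.Nonempty →
    JSep (labelTests H (Multiplicative (ZMod N)) J) (XH ×ˢ S) (YH ×ˢ T) (ZH ×ˢ U) →
      S.card * T.card * U.card ≤ N

/-! ## Translate tests `J_K = ℂ[G]·1_K·ℂ[G]` for a subset `K` (cards `form-transport-cell`; Eisenstein variant recorded as a negative note) -/

section Translate

variable {G : Type} [Group G]

open Classical in
/-- The indicator of the two-sided translate `a K b` of a subset `K ⊆ G`. -/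
def translateInd (K : Set G) (a b : G) : G → ℂ :=
  fun g => if a⁻¹ * g * b⁻¹ ∈ K then 1 else 0

/-- TRANSLATE TESTS `J_K := span{1_{aKb}}` — for a subgroup `K` this is the two-sided ideal `ℂ[G]1_Kℂ[G] =
⊕_{ρ^K ≠ 0} M_ρ` (the `K`-spherical ideal); `K = Sp(Ω)`: FORM-TRANSPORT tests `[gᵀΩ₁g = Ω₂]`;
`K = U`: unipotent-coset tests (principal-series ideal). -/
def translateTests (K : Set G) : Submodule ℂ (G → ℂ) :=
  Submodule.span ℂ (Set.range fun ab : G × G => translateInd K ab.1 ab.2)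

/-- Two-sided translation as a linear map. -/
def biShift (c d : G) : (G → ℂ) →ₗ[ℂ] (G → ℂ) where
  toFun f := fun g => f (c * g * d)
  map_add' f f' := rfl
  map_smul' s f := rfl

theorem biShift_translateInd (K : Set G) (a b c d : G) :
    biShift c d (translateInd K a b) = translateInd K (c⁻¹ * a) (b * d⁻¹) := by
  funext g
  simp only [biShift, LinearMap.coe_mk, AddHom.coe_mk, translateInd]
  have : a⁻¹ * (c * g * d) * b⁻¹ = (c⁻¹ * a)⁻¹ * g * (b * d⁻¹)⁻¹ := by group
  rw [this]

/-- `J_K` is bi-invariant (translates of translate-indicators are translate-indicators). PROVED. -/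
theorem translateTests_biInvariant (K : Set G) :
    BiInvariant (translateTests K : Set (G → ℂ)) := by
  intro f hf c d
  have hmap : Submodule.map (biShift c d) (translateTests K) ≤ translateTests K := by
    unfold translateTests
    rw [Submodule.map_span]
    refine Submodule.span_mono ?_
    rintro _ ⟨_, ⟨⟨a, b⟩, rfl⟩, rfl⟩
    exact ⟨(c⁻¹ * a, b * d⁻¹), (biShift_translateInd K a b c d).symm⟩
  have : biShift c d f ∈ Submodule.map (biShift c d) (translateTests K) := Submodule.mem_map_of_mem hf
  exact hmap this

/-- COSET CERTIFICATE (elementary, PROVED): TPP at the targets + for every target `T` a translate `aKb ∋ T`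
meeting the quadruple set only in `T` ⇒ `J_K`-separated (the separator is `1_{aKb}` itself). -/
theorem cosetCertificate_sep (K : Set G) (X Y Z : Finset G)
    (hT : ∀ x₀ ∈ X, ∀ z₀ ∈ Z, ∀ x ∈ X, ∀ y ∈ Y, ∀ y' ∈ Y, ∀ z ∈ Z,
      x⁻¹ * y * y'⁻¹ * z = x₀⁻¹ * z₀ → x = x₀ ∧ y = y' ∧ z = z₀)
    (hC : ∀ x₀ ∈ X, ∀ z₀ ∈ Z, ∃ a b : G, a⁻¹ * (x₀⁻¹ * z₀) * b⁻¹ ∈ K ∧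
      ∀ x ∈ X, ∀ y ∈ Y, ∀ y' ∈ Y, ∀ z ∈ Z, x⁻¹ * y * y'⁻¹ * z ≠ x₀⁻¹ * z₀ →
        a⁻¹ * (x⁻¹ * y * y'⁻¹ * z) * b⁻¹ ∉ K) :
    JSep (translateTests K : Set (G → ℂ)) X Y Z := by
  intro x₀ hx₀ z₀ hz₀
  obtain ⟨a, b, hin, hout⟩ := hC x₀ hx₀ z₀ hz₀
  refine ⟨translateInd K a b, Submodule.subset_span ⟨(a, b), rfl⟩, fun x hx y hy y' hy' z hz => ?_⟩
  refine ⟨fun h => ?_, fun h => ?_⟩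
  · obtain ⟨rfl, rfl, rfl⟩ := h
    have e : x⁻¹ * y * y⁻¹ * z = x⁻¹ * z := by group
    show translateInd K a b (x⁻¹ * y * y⁻¹ * z) = 1
    rw [e]
    simp only [translateInd]
    rw [if_pos hin]
  · have hne : x⁻¹ * y * y'⁻¹ * z ≠ x₀⁻¹ * z₀ := fun heq => h (hT x₀ hx₀ z₀ hz₀ x hx y hy y' hy' z hz heq)
    show translateInd K a b (x⁻¹ * y * y'⁻¹ * z) = 0
    simp only [translateInd]
    rw [if_neg (hout x hx y hy y' hy' z hz hne)]

end Translate

/-! ## Card C — `form-transport-cell`: `K = Sp(Ω) ≤ GL_{2n}(𝔽_p)`, tests `[gᵀ Ω₁ g = Ω₂]` -/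

/-- `GL_m(𝔽_p)`. -/
abbrev GLp (m p : ℕ) := Matrix.GeneralLinearGroup (Fin m) (ZMod p)

/-- The isometry group of a bilinear form `Ω` on `𝔽_p^m`, as a subset of `GL_m(𝔽_p)`: `gᵀ Ω g = Ω`. -/
def isoSet {m p : ℕ} (Ω : Matrix (Fin m) (Fin m) (ZMod p)) : Set (GLp m p) :=
  {g | (g : Matrix (Fin m) (Fin m) (ZMod p))ᵀ * Ω * (g : Matrix (Fin m) (Fin m) (ZMod p)) = Ω}

/-- FORM-TRANSPORT TESTS `J_Ω := J_{Sp(Ω)}` = span of `[gᵀ Ω₁ g = Ω₂]` over the `GL`-orbit of `Ω`. -/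
def formTests {m p : ℕ} (Ω : Matrix (Fin m) (Fin m) (ZMod p)) : Submodule ℂ (GLp m p → ℂ) :=
  translateTests (isoSet Ω)

/-- The standard symplectic form on `𝔽_p^4` (basis order `e₁ e₂ f₁ f₂`). -/
def stdSymp (p : ℕ) : Matrix (Fin 4) (Fin 4) (ZMod p) :=
  !![0, 0, 1, 0; 0, 0, 0, 1; -1, 0, 0, 0; 0, -1, 0, 0]

/-- FORM BUDGET of the cell `(GL_4(𝔽_p), Sp_4(𝔽_p))` (Klyachko / Bannai–Kawanaka–Song: `Ind_{Sp_4}^{GL_4} 1` is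
multiplicity free; spherical irreps = Lusztig series of DOUBLED semisimple classes `diag(t,t)`:
`C(p−1,2)` of degree `(p²+1)(p²+p+1)` (split `t`), `(p²−p)/2` of degree `(p−1)(p³−1)` (elliptic `t`),
and `p−1` twists each of `1` and `χ_{(2,2)}` (degree `p²(p²+1)`); `p² − 1` irreps in all, degree sum
`= [G:K] = p²(p³−1)(p−1)`, CHECKED for all listed `p` in calc/formcell.py). -/
def FormBudgetGL4 : Prop :=
  ∀ (p : ℕ) [Fact p.Prime], 2 < p → ∀ s : ℝ, 0 ≤ s →
    gradedBudget (GLp 4 p) (formTests (stdSymp p) : Set (GLp 4 p → ℂ)) s ≤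
      ((p - 1) * (p - 2) / 2 : ℝ) * (((p : ℝ) ^ 2 + 1) * ((p : ℝ) ^ 2 + p + 1)) ^ s
        + (((p : ℝ) ^ 2 - p) / 2) * (((p : ℝ) - 1) * ((p : ℝ) ^ 3 - 1)) ^ s
        + ((p : ℝ) - 1) * (((p : ℝ) ^ 2 * ((p : ℝ) ^ 2 + 1)) ^ s + 1)

/-- FORM DESIGNS (the engine): for every `ε` a prime `p`, a dimension `m`, a form `Ω` and a
form-transport-separated triple beating the spherical budget of `(GL_m(𝔽_p), Iso(Ω))`. -/
def FormDesigns : Prop :=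
  ∀ ε : ℝ, 0 < ε → ∃ (p : ℕ) (_ : Fact p.Prime) (m : ℕ) (Ω : Matrix (Fin m) (Fin m) (ZMod p))
    (X Y Z : Finset (GLp m p)),
    JSep (formTests Ω : Set (GLp m p → ℂ)) X Y Z ∧
    gradedBudget (GLp m p) (formTests Ω : Set (GLp m p → ℂ)) (2 + ε) <
      ((X.card * Y.card * Z.card : ℕ) : ℝ) ^ ((2 + ε) / 3)

/-- The form link, PROVED: form designs are instances of the crux (`G = GL_m(𝔽_p)`, `J = J_{Iso(Ω)}`). -/
theorem formLink : FormDesigns → GradedDesignFamily := by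
  intro hD ε hε
  obtain ⟨p, _, m, Ω, X, Y, Z, hsep, hlt⟩ := hD ε hε
  exact ⟨GLp m p, inferInstance, inferInstance, formTests Ω, X, Y, Z,
    translateTests_biInvariant _, hsep, hlt⟩

/-- UNIVERSALITY OF THE `(4, Sp_4)` CELL (statement): a family of form-separated triples in `GL_4(𝔽_p)`
saturating the wall `D(p) ≍ p^{10}` up to a constant along `p → ∞` gives the crux for every `ε`
(`N_eff ≍ p²`, ratio `V^{s/3}/B_s ≍ p^{s−2}`), via `FormBudgetGL4` and `formLink`. -/
def SymplecticWallFamily : Prop :=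
  ∃ c : ℝ, 0 < c ∧ ∀ p₀ : ℕ, ∃ (p : ℕ) (_ : Fact p.Prime), p₀ ≤ p ∧ ∃ X Y Z : Finset (GLp 4 p),
    JSep (formTests (stdSymp p) : Set (GLp 4 p → ℂ)) X Y Z ∧
    c * (p : ℝ) ^ (15 : ℝ) ≤ ((X.card * Y.card * Z.card : ℕ) : ℝ)

theorem symplectic_universality : FormBudgetGL4 → SymplecticWallFamily → GradedDesignFamily := by
  sorry

/-! ## Eisenstein variant (`K = U`, principal-series ideal) — examined, recorded as a negative note -/

/-- Upper unitriangular matrices `U ≤ GL_m(𝔽_p)`, as a set. -/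
def unitri (m p : ℕ) : Set (GLp m p) :=
  {g | (∀ i, (g : Matrix (Fin m) (Fin m) (ZMod p)) i i = 1) ∧
       ∀ i j, j < i → (g : Matrix (Fin m) (Fin m) (ZMod p)) i j = 0}

/-- Eisenstein tests `J_U` (for `m = 2`: all non-cuspidal irreducibles, `= F_1 ⊗ ℂ[det]`). -/
def eisensteinTests (m p : ℕ) : Submodule ℂ (GLp m p → ℂ) := translateTests (unitri m p)

/-- EISENSTEIN BUDGET at `m = 2`: non-cuspidal irreducibles of `GL_2(𝔽_p)` — `p−1` characters, `p−1`
Steinberg twists (degree `p`), `(p−1)(p−2)/2` principal series (degree `p+1`). Recorded to document why the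
variant is budget-DOMINATED by the route's `F_1` cell (`B_3 ≈ p⁵/2` against `F_1`'s `≈ p⁴`). -/
def EisensteinBudgetGL2 : Prop :=
  ∀ (p : ℕ) [Fact p.Prime], 2 < p → ∀ s : ℝ, 0 ≤ s →
    gradedBudget (GLp 2 p) (eisensteinTests 2 p : Set (GLp 2 p → ℂ)) s ≤
      (p - 1 : ℝ) + (p - 1 : ℝ) * (p : ℝ) ^ s + ((p - 1) * (p - 2) / 2 : ℝ) * ((p : ℝ) + 1) ^ s

/-! ## Card B — `graded-stpp-wreath`: simultaneously `J`-separated families -/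

/-- SIMULTANEOUS `J`-SEPARATION of a family `(A i, B i, C i)`: (i) the tree's `SimultaneousTPP`
(CKSU 2005 Def. 5.1), and (ii) every target `a₀⁻¹c₀` of block `l` has ONE separator in `J` vanishing
on all mixed quadruple products `A_i⁻¹ B_i B_j⁻¹ C_j` other than the target.  For `J = ℂ^H` clause
(ii) is automatic and this is the STPP. -/
def SimulSep {H : Type} [Group H] (J : Set (H → ℂ)) {ι : Type} (A B C : ι → Finset H) : Prop :=
  SimultaneousTPP A B C ∧
    ∀ l, ∀ a₀ ∈ A l, ∀ c₀ ∈ C l, ∃ f ∈ J, f (a₀⁻¹ * c₀) = 1 ∧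
      ∀ i j, ∀ a ∈ A i, ∀ b ∈ B i, ∀ b' ∈ B j, ∀ c ∈ C j,
        a⁻¹ * b * b'⁻¹ * c ≠ a₀⁻¹ * c₀ → f (a⁻¹ * b * b'⁻¹ * c) = 0

/-- A single `J`-separated triple is a simultaneously separated family of size one (sanity). -/
theorem simulSep_singleton {H : Type} [Group H] [DecidableEq H] (J : Set (H → ℂ))
    (X Y Z : Finset H) (hT : TripleProductProperty X Y Z) (hY : Y.Nonempty) (h : JSep J X Y Z) :
    SimulSep J (fun _ : Unit => X) (fun _ => Y) (fun _ => Z) := by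
  refine ⟨⟨fun _ => hT, fun _ _ _ _ _ _ _ _ _ _ _ _ _ _ _ _ =>
    ⟨Subsingleton.elim _ _, Subsingleton.elim _ _⟩⟩, ?_⟩
  intro l a₀ ha₀ c₀ hc₀
  obtain ⟨y₁, hy₁⟩ := hY
  obtain ⟨f, hf, hsep⟩ := h a₀ ha₀ c₀ hc₀
  refine ⟨f, hf, ?_, ?_⟩
  · have := (hsep a₀ ha₀ y₁ hy₁ y₁ hy₁ c₀ hc₀).1 ⟨rfl, rfl, rfl⟩
    simpa [mul_inv_cancel_right] using this
  · intro i j a ha b hb b' hb' c hc hne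
    refine (hsep a ha b hb b' hb' c hc).2 ?_
    rintro ⟨rfl, rfl, rfl⟩
    exact hne (by simp [mul_inv_cancel_right])

/-- GRADED STPP FAMILIES: for every `ε`, a finite host, a bi-invariant `J` and a simultaneously
`J`-separated family whose exponent-`(2+ε)` volumes beat the graded budget IN SUM. -/
def GradedSTPPFamily : Prop :=
  ∀ ε : ℝ, 0 < ε → ∃ (H : Type) (_ : Group H) (_ : Fintype H) (_ : DecidableEq H)
    (J : Submodule ℂ (H → ℂ)) (M : ℕ) (A B C : Fin M → Finset H),
    BiInvariant (J : Set (H → ℂ)) ∧ SimulSep (J : Set (H → ℂ)) A B C ∧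
    gradedBudget H (J : Set (H → ℂ)) (2 + ε) <
      ∑ i, (((A i).card * (B i).card * (C i).card : ℕ) : ℝ) ^ ((2 + ε) / 3)

/-- THE GRADED CKSU INEQUALITY (family form of `GradedPricing`; CKSU 2005 Thm 7.1 / BCCGU 2017 Thm 2.6
with `Irr H` replaced by `Irr H ∩ J`): wreath host `S_n ⋉ H^n`, test space `J^{⊗ n} ⊗ ℂ^{S_n}`, whose
irreducible content is the `R`-coloured wreath irreps, budget `≤ (n!)^{s-1}(Σ_R d^s)^n` (graded CKSU
Lemma 1.2), plus the tensor-power trick. -/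
def GradedCKSU : Prop :=
  ∀ (H : Type) [Group H] [Fintype H] [DecidableEq H] (J : Submodule ℂ (H → ℂ)),
    BiInvariant (J : Set (H → ℂ)) → ∀ (M : ℕ) (A B C : Fin M → Finset H),
      SimulSep (J : Set (H → ℂ)) A B C →
        ∑ i, (((A i).card * (B i).card * (C i).card : ℕ) : ℝ) ^
            (Literature.Computability.AlgebraicComplexity.omega ℂ / 3)
          ≤ gradedBudget H (J : Set (H → ℂ)) (Literature.Computability.AlgebraicComplexity.omega ℂ)

/-- FIRST LEMMA of card B (TRANSFER, XL): a graded STPP family at `ε` yields ONE `J_wr`-separated triple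
in a wreath host beating its graded budget at the same `ε` (CKSU's wreath construction Thm 7.1 +
Lemma 1.1 weighting + tensor powers, graded). -/
theorem gradedCKSU_transfer : GradedSTPPFamily → GradedDesignFamily := by
  sorry

/-- Alternative assembly through the family inequality (ε := ω − 2, exactly as the route's `closes`). -/
theorem closes_of_gradedCKSU (hP : GradedCKSU) (hF : GradedSTPPFamily) : MatrixMultiplication := by
  sorry

end Summit.MatrixMultiplication.MatrixMultiplication.Cruxes.GradedDesignFamily.Ideator3

end
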